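import Summits.ResolutionOfSingularities.ResolutionOfSingularities.Theorems.TeissierJungTeissierResolveRegularBranches
import Literature.AlgebraicGeometry.Resolution.TeissierPresentation
import Literature.AlgebraicGeometry.Resolution.PowerSeriesRegularLocal
import HarnessLib

/-!
# `TeissierResolve` — support lemmas III: Teissier presentations with `g = 0` are regular points

Support lemmas for the crux `stmt-ResolutionOfSingularities-17086`
(`Summit.ResolutionOfSingularities.ResolutionOfSingularities.Theses.TeissierJung.TeissierResolve`).
A Teissier datum (`Literature.AlgebraicGeometry.Resolution.Teissier.IsDatum`, Mourtada–Schober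
2025 §3) with `g = 0` steps has NO equations: the presented ring is
`k⟦x₁, …, x_d⟧[∅] ⧸ (∅) = k⟦x₁, …, x_d⟧`, a regular local ring. Hence the regular-branch theorem
of `TeissierJungTeissierResolveRegularBranches.lean` covers exactly the Teissier-presented schemes
all of whose branches are presented with `g = 0`:

* `Teissier.ideal_eq_bot_of_isEmpty` — over `Fin 0` the ideal of the presentation is `⊥`;
* `isRegularLocalRing_of_ringEquiv_teissierQuotient_zero` — a ring isomorphic to
  `k⟦x⟧[u : Fin 0] ⧸ (E : Fin 0)` is a regular local ring;
* `hasResolution_of_teissierZero_branches` — an integral scheme of finite type over a field whose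
  analytic branches at closed points all carry a `g = 0` Teissier presentation has a resolution
  (its normalisation).

[folklore]; no definitions, no named facts.
-/

noncomputable section

set_option linter.dupNamespace false -- mandated namespace of this single-conjunct summit

open IsLocalRing
open Literature.AlgebraicGeometry.Resolution

namespace Summit.ResolutionOfSingularities.ResolutionOfSingularities.Theorems.TeissierResolve.RegularBranches

universe u v

/-- With `g = 0` steps the Teissier ideal `(E₀, …, E_{g-1})` is the zero ideal (there are no
equations). [folklore] -/
theorem Teissier.ideal_eq_bot_of_isEmpty {k : Type u} [CommRing k] {d : ℕ} (n : Fin 0 → ℕ)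
    (c : Fin 0 → k) (A : Fin 0 → (Fin d →₀ ℕ)) (mu : Fin 0 → (Fin 0 →₀ ℕ))
    (h : Fin 0 → MvPolynomial (Fin 0) (MvPowerSeries (Fin d) k)) :
    Teissier.ideal n c A mu h = ⊥ := by
  rw [Teissier.ideal, Set.range_eq_empty, Ideal.span_empty]

/-- **A ring with a `g = 0` Teissier presentation is a regular local ring**: it is isomorphic to
`k⟦x₁, …, x_d⟧[u : Fin 0] ⧸ ⊥ ≅ k⟦x₁, …, x_d⟧` (Matsumura §19: power series rings over a field
are regular local, the tree's `isRegularLocalRing_mvPowerSeries_fin`). [folklore] -/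
theorem isRegularLocalRing_of_ringEquiv_teissierQuotient_zero {k : Type u} [Field k] {d : ℕ}
    {B : Type v} [CommRing B] (n : Fin 0 → ℕ) (c : Fin 0 → k) (A : Fin 0 → (Fin d →₀ ℕ))
    (mu : Fin 0 → (Fin 0 →₀ ℕ)) (h : Fin 0 → MvPolynomial (Fin 0) (MvPowerSeries (Fin d) k))
    (ψ : B ≃+* (MvPolynomial (Fin 0) (MvPowerSeries (Fin d) k) ⧸ Teissier.ideal n c A mu h)) :
    IsRegularLocalRing B := by
  haveI := (isRegularLocalRing_mvPowerSeries_fin k d).1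
  have hbot := Teissier.ideal_eq_bot_of_isEmpty n c A mu h
  -- `k⟦x⟧[u : Fin 0] ⧸ ⊥ ≅ k⟦x⟧[u : Fin 0] ≅ k⟦x⟧`
  let e : (MvPolynomial (Fin 0) (MvPowerSeries (Fin d) k) ⧸ Teissier.ideal n c A mu h) ≃+*
      MvPowerSeries (Fin d) k :=
    ((Ideal.quotEquivOfEq hbot).trans (RingEquiv.quotientBot _)).trans
      (MvPolynomial.isEmptyAlgEquiv (MvPowerSeries (Fin d) k) (Fin 0)).toRingEquiv
  exact IsRegularLocalRing.of_ringEquiv (ψ.trans e).symm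

open CategoryTheory AlgebraicGeometry in
/-- **Schemes all of whose analytic branches are Teissier-presented with `g = 0` are resolved by
their normalisation.** For `X` integral of finite type over a field `k`: if at every closed point
`x` every branch `𝒪̂_{X,x} ⧸ P` (`P` a minimal prime) is ring-isomorphic to
`k⟦x₁, …, x_d⟧[u : Fin 0] ⧸ (E : Fin 0)` for some `g = 0` datum, then `Scheme.HasResolution X`
(`isRegularLocalRing_of_ringEquiv_teissierQuotient_zero` + `hasResolution_of_branches_regular`).
This is the `g = 0` slice of the crux `TeissierResolve`. [folklore] -/
theorem hasResolution_of_teissierZero_branches {k : Type u} [Field k] (X : Scheme.{u})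
    [IsIntegral X] (f : X ⟶ Spec (.of k)) [LocallyOfFiniteType f] [QuasiCompact f]
    (h : ∀ x : X, IsClosed ({x} : Set X) →
      ∀ P ∈ minimalPrimes (AdicCompletion (maximalIdeal (X.presheaf.stalk x)) (X.presheaf.stalk x)),
        ∃ (d : ℕ) (n : Fin 0 → ℕ) (c : Fin 0 → k) (A : Fin 0 → (Fin d →₀ ℕ))
          (mu : Fin 0 → (Fin 0 →₀ ℕ)) (hh : Fin 0 → MvPolynomial (Fin 0) (MvPowerSeries (Fin d) k)),
          Nonempty ((AdicCompletion (maximalIdeal (X.presheaf.stalk x)) (X.presheaf.stalk x) ⧸ P) ≃+*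
            (MvPolynomial (Fin 0) (MvPowerSeries (Fin d) k) ⧸ Teissier.ideal n c A mu hh))) :
    Scheme.HasResolution X :=
  hasResolution_of_branches_regular X f fun x hx P hP => by
    obtain ⟨d, n, c, A, mu, hh, ⟨ψ⟩⟩ := h x hx P hP
    exact isRegularLocalRing_of_ringEquiv_teissierQuotient_zero n c A mu hh ψ

end Summit.ResolutionOfSingularities.ResolutionOfSingularities.Theorems.TeissierResolve.RegularBranches

end
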